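import Literature.AlgebraicGeometry.ModuliOfAbelianVarieties.SiegelShimuraSetLevelFibres
import HarnessLib

/-!
# Hecke translates commute with change of level on the Siegel Shimura set
# ([Deligne1971TravauxShimura] Déf. 3.1; [Milne2005ShimuraVarieties] Thm. 5.17, Thm. 13.6)

Topic `AlgebraicGeometry/ModuliOfAbelianVarieties`; namespace `Literature.AlgebraicGeometry.ModuliOfAbelianVarieties`.
THEOREMS ONLY (no definition, no named fact, no instance, no `sorry`; net debt 0).  Cell hodgecm-mathlib, #60 road
(A-p05 g7 table, node R60-7c «Hecke translates commute with change of level»; MUMFORD-LINE-SPEC §4 HECKE/TRANSITIONS;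
director g6 RULING s86 (2)(b) banked generic leaf).  Sequel of ★ R60-7 `SiegelShimuraSetHeckeTranslate` (the right translates
`T_γ : [J, aK] ↦ [J, aγK]`), ★ R60-13c `SiegelShimuraSetLevelChange` (B-p01: `SiegelShimuraSet.restrict`) and ★ R60-7b′
`SiegelShimuraSetLevelFibres`.

THE PRINT.  [Deligne1971TravauxShimura] Déf. 3.1 p. 136: a model is «muni de l'action de `G(𝔸_f)`» on the projective SYSTEM
`(_K M)_K` — the right translates are compatible with the transition maps; [Milne2005ShimuraVarieties] Thm. 5.17 p. 60 (the
projective system and the action of `G(𝔸_f)` on it: `T(g) : Sh_K → Sh_{g⁻¹Kg}` compatible with `Sh_{K′} → Sh_K`) and Thm. 13.6 p. 118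
(the same on the canonical model).

WHAT IS HERE (every translate is handled through its characterising equation `T [J, aK] = [J, aγK]`, as ★ R60-7 states it — no
definition): §1 `SiegelShimuraSet.restrict_rightTranslate` — for `K₁ ≤ K₂`, translates `T₁` on `Sh_{K₁}` and `T₂` on `Sh_{K₂}` by
the same `γ` satisfy `restrict (T₁ c) = T₂ (restrict c)`; `rightTranslate_eq_self_of_mem` — `T = id` when `γ ∈ K`;
`rightTranslate_rightTranslate` / `rightTranslate_one` — the translates compose as a right action (`T_γ ∘ T_{γ′} = T_{γ′γ}`,
`T_1 = id`); so on the principal tower the right `K_δ(1)`-action on `Sh_{K_δ(N)}` factors through the finite `K_δ(1)/K_δ(N)`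
and is compatible along `N ∣ N′`.  §2 the same on the complex points of a ★ `SiegelComplexRecordSystem`: the point translates of
★ `SiegelComplexRecordSystem.existsUnique_pointTranslate` commute with the algebraic transitions `Sg.Mc.map f` (field `map_pts`).

## References
* [Deligne1971TravauxShimura] P. Deligne, *Travaux de Shimura*, Sém. Bourbaki 389 (1971): Déf. 3.1 p. 136; 1.8 p. 129; 4.16–4.17 p. 150.
* [Milne2005ShimuraVarieties] J. S. Milne, *Introduction to Shimura varieties* (2005): Thm. 5.17 p. 60; Thm. 13.6 p. 118.
-/

set_option autoImplicit false

noncomputable section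

open Matrix NumberField IsDedekindDomain

namespace Literature.AlgebraicGeometry.ModuliOfAbelianVarieties

variable {g : ℕ}

/-! ### §1. Translates vs. change of level on the Shimura set -/

section ShimuraSet

variable {δ : Fin g → ℕ} {K K₁ K₂ : Subgroup (gspFinAdelic δ)}

/-- **Right translates commute with change of level**: if `T₁` translates `Sh_{K₁}` and `T₂` translates `Sh_{K₂}` by the same
`γ` (`Tᵢ [J, aKᵢ] = [J, aγKᵢ]`, ★ `SiegelShimuraSet.existsUnique_rightTranslate`), then `restrict (T₁ c) = T₂ (restrict c)` for
`K₁ ≤ K₂`. [cite: Deligne1971TravauxShimura, Déf. 3.1 p. 136] [cite: Milne2005ShimuraVarieties, Thm. 5.17 p. 60] -/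
theorem SiegelShimuraSet.restrict_rightTranslate (hle : K₁ ≤ K₂) {γ : gspFinAdelic δ}
    {T₁ : SiegelShimuraSet δ K₁ → SiegelShimuraSet δ K₁} {T₂ : SiegelShimuraSet δ K₂ → SiegelShimuraSet δ K₂}
    (hT₁ : ∀ (J : C0pm δ) (a : gspFinAdelic δ), T₁ (SiegelShimuraSet.mk δ K₁ J a) = SiegelShimuraSet.mk δ K₁ J (a * γ))
    (hT₂ : ∀ (J : C0pm δ) (a : gspFinAdelic δ), T₂ (SiegelShimuraSet.mk δ K₂ J a) = SiegelShimuraSet.mk δ K₂ J (a * γ))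
    (c : SiegelShimuraSet δ K₁) :
    SiegelShimuraSet.restrict δ hle (T₁ c) = T₂ (SiegelShimuraSet.restrict δ hle c) := by
  obtain ⟨⟨J, a⟩, rfl⟩ := SiegelShimuraSet.mk_surjective δ K₁ c
  change SiegelShimuraSet.restrict δ hle (T₁ (SiegelShimuraSet.mk δ K₁ J a)) =
    T₂ (SiegelShimuraSet.restrict δ hle (SiegelShimuraSet.mk δ K₁ J a))
  rw [hT₁, SiegelShimuraSet.restrict_mk, SiegelShimuraSet.restrict_mk, hT₂]

/-- **Translates by elements of the level act trivially**: a translate of `Sh_K` by `γ ∈ K` is the identity.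
[cite: Milne2005ShimuraVarieties, §5 (5.1) p. 56] -/
theorem SiegelShimuraSet.rightTranslate_eq_self_of_mem {γ : gspFinAdelic δ} (hγ : γ ∈ K)
    {T : SiegelShimuraSet δ K → SiegelShimuraSet δ K}
    (hT : ∀ (J : C0pm δ) (a : gspFinAdelic δ), T (SiegelShimuraSet.mk δ K J a) = SiegelShimuraSet.mk δ K J (a * γ))
    (c : SiegelShimuraSet δ K) : T c = c := by
  obtain ⟨⟨J, a⟩, rfl⟩ := SiegelShimuraSet.mk_surjective δ K c
  change T (SiegelShimuraSet.mk δ K J a) = SiegelShimuraSet.mk δ K J a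
  rw [hT, SiegelShimuraSet.mk_mul_eq_mk_of_mem hγ]

/-- **The translates compose as a right action**: `T_γ (T_{γ′} c) = T_{γ′γ} c` (each translate given by its characterising
equation). [cite: Deligne1971TravauxShimura, Déf. 3.1 p. 136] [cite: Milne2005ShimuraVarieties, Thm. 5.17 p. 60] -/
theorem SiegelShimuraSet.rightTranslate_rightTranslate {γ γ' : gspFinAdelic δ}
    {T T' T'' : SiegelShimuraSet δ K → SiegelShimuraSet δ K}
    (hT : ∀ (J : C0pm δ) (a : gspFinAdelic δ), T (SiegelShimuraSet.mk δ K J a) = SiegelShimuraSet.mk δ K J (a * γ))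
    (hT' : ∀ (J : C0pm δ) (a : gspFinAdelic δ), T' (SiegelShimuraSet.mk δ K J a) = SiegelShimuraSet.mk δ K J (a * γ'))
    (hT'' : ∀ (J : C0pm δ) (a : gspFinAdelic δ), T'' (SiegelShimuraSet.mk δ K J a) = SiegelShimuraSet.mk δ K J (a * (γ' * γ)))
    (c : SiegelShimuraSet δ K) : T (T' c) = T'' c := by
  obtain ⟨⟨J, a⟩, rfl⟩ := SiegelShimuraSet.mk_surjective δ K c
  change T (T' (SiegelShimuraSet.mk δ K J a)) = T'' (SiegelShimuraSet.mk δ K J a)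
  rw [hT', hT, hT'', mul_assoc]

/-- The translate by `1` is the identity. [cite: Milne2005ShimuraVarieties, §5 (5.1) p. 56] -/
theorem SiegelShimuraSet.rightTranslate_one {T : SiegelShimuraSet δ K → SiegelShimuraSet δ K}
    (hT : ∀ (J : C0pm δ) (a : gspFinAdelic δ), T (SiegelShimuraSet.mk δ K J a) = SiegelShimuraSet.mk δ K J (a * 1))
    (c : SiegelShimuraSet δ K) : T c = c :=
  SiegelShimuraSet.rightTranslate_eq_self_of_mem K.one_mem hT c

/-- Principal tower: for `N ∣ N′` and `γ ∈ K_δ(1)` the translates `T_γ` on `Sh_{K_δ(N′)}` and on `Sh_{K_δ(N)}` (both exist and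
are unique, ★ `SiegelShimuraSet.existsUnique_rightTranslate_principal`) commute with `restrict`; and `T_γ = id` on `Sh_{K_δ(N)}`
for `γ ∈ K_δ(N)` — the right `GSp_δ(ℤ̂)`-action on the principal system factors levelwise through `GSp_δ(ℤ̂)/K_δ(N)`.
[cite: Deligne1971TravauxShimura, 4.16–4.17 p. 150] [cite: Milne2005ShimuraVarieties, Thm. 13.6 p. 118] -/
theorem SiegelShimuraSet.exists_rightTranslate_restrict_comm {N N' : ℕ} (h : N ∣ N') {γ : gspFinAdelic δ}
    (hγ : γ ∈ principalLevelSubgroup δ 1) :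
    ∃ (T₁ : SiegelShimuraSet δ (principalLevelSubgroup δ N') → SiegelShimuraSet δ (principalLevelSubgroup δ N'))
      (T₂ : SiegelShimuraSet δ (principalLevelSubgroup δ N) → SiegelShimuraSet δ (principalLevelSubgroup δ N)),
      (∀ (J : C0pm δ) (a : gspFinAdelic δ),
          T₁ (SiegelShimuraSet.mk δ (principalLevelSubgroup δ N') J a) =
            SiegelShimuraSet.mk δ (principalLevelSubgroup δ N') J (a * γ)) ∧
        (∀ (J : C0pm δ) (a : gspFinAdelic δ),
            T₂ (SiegelShimuraSet.mk δ (principalLevelSubgroup δ N) J a) =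
              SiegelShimuraSet.mk δ (principalLevelSubgroup δ N) J (a * γ)) ∧
          ∀ c, SiegelShimuraSet.restrict δ (principalLevelSubgroup_anti δ h) (T₁ c) =
            T₂ (SiegelShimuraSet.restrict δ (principalLevelSubgroup_anti δ h) c) := by
  obtain ⟨T₁, hT₁, -⟩ := SiegelShimuraSet.existsUnique_rightTranslate_principal (δ := δ) (N := N') hγ
  obtain ⟨T₂, hT₂, -⟩ := SiegelShimuraSet.existsUnique_rightTranslate_principal (δ := δ) (N := N) hγ
  exact ⟨T₁, T₂, hT₁, hT₂, SiegelShimuraSet.restrict_rightTranslate (principalLevelSubgroup_anti δ h) hT₁ hT₂⟩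

end ShimuraSet

/-! ### §2. On the complex points of a Siegel complex record system -/

section RecordSystem

variable {δ : Fin g → ℕ}

/-- **The point translates commute with the algebraic transitions**: for `f : K₁ ⟶ K₂` and point translates `P₁` on `Mc_{K₁}(ℂ)`,
`P₂` on `Mc_{K₂}(ℂ)` by the same `γ` (`Pᵢ ((ptsᵢ)⁻¹[J, aKᵢ]) = (ptsᵢ)⁻¹[J, aγKᵢ]`, ★
`SiegelComplexRecordSystem.existsUnique_pointTranslate`): `(Sg.Mc.map f)(ℂ) ∘ P₁ = P₂ ∘ (Sg.Mc.map f)(ℂ)` (field `map_pts`).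
[cite: Deligne1971TravauxShimura, Déf. 3.1 p. 136] [cite: Milne2005ShimuraVarieties, Thm. 13.6 p. 118] -/
theorem SiegelComplexRecordSystem.map_pointTranslate (Sg : SiegelComplexRecordSystem g δ) {K₁ K₂ : SiegelLevel δ}
    (f : K₁ ⟶ K₂) {γ : gspFinAdelic δ}
    {P₁ : Motives.ComplexPoints (Sg.Mc.obj K₁) → Motives.ComplexPoints (Sg.Mc.obj K₁)}
    {P₂ : Motives.ComplexPoints (Sg.Mc.obj K₂) → Motives.ComplexPoints (Sg.Mc.obj K₂)}
    (hP₁ : ∀ (J : C0pm δ) (a : gspFinAdelic δ),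
      P₁ ((Sg.pts K₁).symm (SiegelShimuraSet.mk δ K₁.1 J a)) = (Sg.pts K₁).symm (SiegelShimuraSet.mk δ K₁.1 J (a * γ)))
    (hP₂ : ∀ (J : C0pm δ) (a : gspFinAdelic δ),
      P₂ ((Sg.pts K₂).symm (SiegelShimuraSet.mk δ K₂.1 J a)) = (Sg.pts K₂).symm (SiegelShimuraSet.mk δ K₂.1 J (a * γ)))
    (x : Motives.ComplexPoints (Sg.Mc.obj K₁)) :
    Motives.AlgPoints.map (Sg.Mc.map f) (P₁ x) = P₂ (Motives.AlgPoints.map (Sg.Mc.map f) x) := by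
  obtain ⟨⟨J, a⟩, hJa⟩ := SiegelShimuraSet.mk_surjective δ K₁.1 (Sg.pts K₁ x)
  have hx : x = (Sg.pts K₁).symm (SiegelShimuraSet.mk δ K₁.1 J a) := by
    rw [Equiv.eq_symm_apply]; exact hJa.symm
  rw [hx, hP₁, ← SiegelRationalModel.ptsSymm_mk_eq_map Sg f J (a * γ), ← SiegelRationalModel.ptsSymm_mk_eq_map Sg f J a, hP₂]

end RecordSystem

end Literature.AlgebraicGeometry.ModuliOfAbelianVarieties

end
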